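import Summits.ResolutionOfSingularities.ResolutionOfSingularities.Theorems.FrobeniusLadderFInjectiveMacaulayficationQuarticTStep
import Summits.ResolutionOfSingularities.ResolutionOfSingularities.Theorems.FrobeniusLadderFInjectiveMacaulayficationX2QuarticPointFloor
import HarnessLib

/-!
# ★★★ THE QUARTIC T-SIDE CLASS ROW: for every quartic form `F(y,u,t,s)` with `x² + F` prime, `Y` regular off the vertex and SMOOTH chart quartics — SCOPE ∧ LEGAL-AND-FULL point floor ∧
# `TStepInstanceAt p v 𝔪̃`, every `p ≠ 2` (habitat #3a at class level: NON-NORMAL FULL floors regularised by ONE blowing up of the reduced exceptional divisor, a codimension-one centre)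
# (crux `FInjectiveMacaulayfication` stmt-ResolutionOfSingularities-15315, chain w45a; assembles this seat's ✓p686889 `QuarticTStep.tStepInstanceAt_of_doublePoint_quarticCharts` with
# res-L1-w45a-stub-1 g14's degree-generic front end ✓ `X2FormPointFloor` and floor package ✓ `X2QuarticPointFloor.pointFloor_legal_full_quartic`; seat res-L1-w45a-lead-1 g11)

[OURS · L1 W4.5a] Support file (`--supports stmt-ResolutionOfSingularities-15315 --as helper`); def-free; UNCONDITIONAL; no named fact; NOT a statement of any manuscript. CLASS-LEVEL instance
theorem with non-vacuity for the inner block of the T″ stub (second habitat); vertex FULLness stays per bed (✓p684332 for the signed Fermat quartic); T″ and the F-half OPEN; nothing of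
the crux proved. AI-written (AI review is weaker than expert review).

* ★★★ `tStepInstanceAt_of_doublePoint_quarticForm` — `TStepInstanceAt p v 𝔪̃` for every field with `2 ≠ 0`, every `p`, every quartic form as above (strict transforms by
  `X2FormPointFloor.theta_four_deg/theta_castSucc_deg` at `d = 4`).
* ★★★ `tStep_classRow_quarticForm` — (SCOPE: `v` closed ∧ singular ∧ `dim 4`) ∧ (for EVERY blowing up along the point floor: legal ∧ CM ∧ FULL at every stalk) ∧ instance, `p ≠ 2`.
[folklore assembly; cite: GortzWedhorn2020, Prop. 13.91 (2); Liu2002, Thm. 8.1.19 (a); Kollar2007, §2.5; Fedder1983, Thm. 1.12]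
-/

-- single-problem summit: the doubled namespace component is forced
set_option linter.dupNamespace false

noncomputable section

namespace Summit.ResolutionOfSingularities.ResolutionOfSingularities.Theorems.FInjectiveMacaulayfication.QuarticFrontEnd

open CategoryTheory CategoryTheory.Limits AlgebraicGeometry TopologicalSpace IsLocalRing MvPolynomial
open Literature.AlgebraicGeometry.Resolution
open Summit.ResolutionOfSingularities.ResolutionOfSingularities.Theorems.FInjectiveMacaulayfication
open SliceableCentre GermOfGlobalBlowup

variable (k : Type) [Field k]

/-- ★★★ **`TStepInstanceAt` FOR EVERY QUARTIC FORM WITH SMOOTH CHART QUARTICS** (`2 ≠ 0`; `f = X₄² + F` prime, `Y` regular off `v`): for every blowing up of `Spec 𝒪_{Y,v}` along the point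
floor, ONE blowing up along the reduced singular locus (the reduced exceptional divisor, codimension one) has all its blowings up REGULAR. [OURS · class-level certificate theorem] -/
theorem tStepInstanceAt_of_doublePoint_quarticForm (h2 : (2 : k) ≠ 0) (p : ℕ) (F : MvPolynomial (Fin 4) k) (hF : F.IsHomogeneous 4) (f : MvPolynomial (Fin 5) k)
    (hf : f = X 4 ^ 2 + rename (Fin.castSucc : Fin 4 → Fin 5) F) (hprime : Prime f)
    (hoff : ∀ (P : Ideal (MvPolynomial (Fin 5) k ⧸ Ideal.span {f})) [P.IsPrime],
      ¬ Ideal.span (Set.range fun j : Fin 5 => Ideal.Quotient.mk (Ideal.span {f}) (X j)) ≤ P → IsRegularLocalRing (Localization.AtPrime P))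
    (hws : ∀ (a : Fin 4) (Q : Ideal (MvPolynomial (Fin 3) k)), Q.IsPrime →
      MvPolynomial.aeval ((![![1, X 0, X 1, X 2], ![X 0, 1, X 1, X 2], ![X 0, X 1, 1, X 2], ![X 0, X 1, X 2, 1]] : Fin 4 → Fin 4 → MvPolynomial (Fin 3) k) a) F ∈ Q →
      ∃ D : Derivation k (MvPolynomial (Fin 3) k) (MvPolynomial (Fin 3) k),
        D (MvPolynomial.aeval ((![![1, X 0, X 1, X 2], ![X 0, 1, X 1, X 2], ![X 0, X 1, 1, X 2], ![X 0, X 1, X 2, 1]] : Fin 4 → Fin 4 → MvPolynomial (Fin 3) k) a) F) ∉ Q)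
    (v : Spec (.of (MvPolynomial (Fin 5) k ⧸ Ideal.span {f})))
    (hv : v.asIdeal = Ideal.span (Set.range fun j : Fin 5 => Ideal.Quotient.mk (Ideal.span {f}) (X j))) :
    TStepGerm.TStepInstanceAt p v ((affineBlowup.idealSheaf (Ideal.span (Set.range fun j : Fin 5 => Ideal.Quotient.mk (Ideal.span {f}) (X j)))).comap
      ((Spec (.of (MvPolynomial (Fin 5) k ⧸ Ideal.span {f}))).fromSpecStalk v)) := by
  have hF0 : F ≠ 0 := X2QuarticPointFloor.F_ne_zero_of_smooth k F hws
  -- the strict transforms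
  obtain ⟨G, hG⟩ : ∃ G : Fin 5 → MvPolynomial (Fin 5) k, G = fun i : Fin 5 =>
      if h : i = 4 then 1 + X 4 ^ 2 * rename (Fin.castSucc : Fin 4 → Fin 5) F
      else X 4 ^ 2 + X i ^ 2 * rename ((![![1, 2, 3], ![0, 2, 3], ![0, 1, 3], ![0, 1, 2]] : Fin 4 → Fin 3 → Fin 5) (i.castPred h))
        (MvPolynomial.aeval ((![![1, X 0, X 1, X 2], ![X 0, 1, X 1, X 2], ![X 0, X 1, 1, X 2], ![X 0, X 1, X 2, 1]] :
          Fin 4 → Fin 4 → MvPolynomial (Fin 3) k) (i.castPred h)) F) := ⟨_, rfl⟩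
  have hG4 : G 4 = 1 + X 4 ^ 2 * rename (Fin.castSucc : Fin 4 → Fin 5) F := by rw [hG]; simp
  have hGw : ∀ a : Fin 4, G (Fin.castSucc a) = X 4 ^ 2 + X (Fin.castSucc a) ^ 2 *
      rename ((![![1, 2, 3], ![0, 2, 3], ![0, 1, 3], ![0, 1, 2]] : Fin 4 → Fin 3 → Fin 5) a)
        (MvPolynomial.aeval ((![![1, X 0, X 1, X 2], ![X 0, 1, X 1, X 2], ![X 0, X 1, 1, X 2], ![X 0, X 1, X 2, 1]] :
          Fin 4 → Fin 4 → MvPolynomial (Fin 3) k) a) F) := by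
    intro a
    have ha4 : Fin.castSucc a ≠ (4 : Fin 5) := (Fin.castSucc_lt_last a).ne
    rw [hG]
    dsimp only
    rw [dif_neg ha4, Fin.castPred_castSucc]
  have hθ : ∀ i : Fin 5, MvPolynomial.aeval (fun j : Fin 5 => if j = i then (X i : MvPolynomial (Fin 5) k) else X j * X i) f = X i ^ 2 * G i := by
    intro i
    by_cases hi : i = 4
    · subst hi; rw [hG4]; exact X2FormPointFloor.theta_four_deg k 4 (by norm_num) F hF f hf
    · have : i = Fin.castSucc (i.castPred hi) := (Fin.castSucc_castPred i hi).symm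
      rw [this, hGw]
      exact X2FormPointFloor.theta_castSucc_deg k 4 (by norm_num) F hF f hf _
  exact QuarticTStep.tStepInstanceAt_of_doublePoint_quarticCharts k h2 p f hprime (X2FormPointFloor.constantCoeff_f_deg k 4 (by norm_num) F hF f hf)
    (X2FormPointFloor.f_not_mem_span_X_deg k 4 (by norm_num) F hF hF0 f hf) hoff G hθ _ hGw hws _ hG4 (X2CubicFormFrontEnd.pderiv_rename_castSucc k F) v hv

/-- ★★★ **THE QUARTIC T-SIDE CLASS ROW.** For every field `k` of characteristic `p ≠ 2`, every quartic form `F ∈ k[Y₀..Y₃]` such that `f = X₄² + F` is PRIME, `Y = Spec k[X]/(f)` is regular off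
the vertex `v`, and the four dehomogenisations `F|_{Y_a=1}` have SMOOTH zero locus (pointwise derivations): (SCOPE) `v` closed ∧ `v ∉ Reg Y` ∧ `dim 𝒪_{Y,v} = 4`; (LEGAL-AND-FULL FLOOR,
res-L1-w45a-stub-1's ✓ `X2QuarticPointFloor.pointFloor_legal_full_quartic`) for EVERY blowing up `S′ → Spec 𝒪_{Y,v}` along `I = 𝔪̃·𝒪_{Y,v}`: (`I ≠ ⊥` ∧ `Supp I ⊆ (Reg)ᶜ` ∧ `S′` regular off the
closed fibre ∧ CM stalks) ∧ `S′` FULL at every stalk — a NON-NORMAL floor; (INSTANCE) `TStepGerm.TStepInstanceAt p v I`. Vertex FULLness (T″'s outer hypothesis) is per bed (✓p684332).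
[OURS · class-level certificate theorem with non-vacuity] -/
theorem tStep_classRow_quarticForm (p : ℕ) [Fact p.Prime] [CharP k p] (hp2 : p ≠ 2) (F : MvPolynomial (Fin 4) k) (hF : F.IsHomogeneous 4) (f : MvPolynomial (Fin 5) k)
    (hf : f = X 4 ^ 2 + rename (Fin.castSucc : Fin 4 → Fin 5) F) (hprime : Prime f)
    (hoff : ∀ (P : Ideal (MvPolynomial (Fin 5) k ⧸ Ideal.span {f})) [P.IsPrime],
      ¬ Ideal.span (Set.range fun j : Fin 5 => Ideal.Quotient.mk (Ideal.span {f}) (X j)) ≤ P → IsRegularLocalRing (Localization.AtPrime P))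
    (hws : ∀ (a : Fin 4) (Q : Ideal (MvPolynomial (Fin 3) k)), Q.IsPrime →
      MvPolynomial.aeval ((![![1, X 0, X 1, X 2], ![X 0, 1, X 1, X 2], ![X 0, X 1, 1, X 2], ![X 0, X 1, X 2, 1]] : Fin 4 → Fin 4 → MvPolynomial (Fin 3) k) a) F ∈ Q →
      ∃ D : Derivation k (MvPolynomial (Fin 3) k) (MvPolynomial (Fin 3) k),
        D (MvPolynomial.aeval ((![![1, X 0, X 1, X 2], ![X 0, 1, X 1, X 2], ![X 0, X 1, 1, X 2], ![X 0, X 1, X 2, 1]] : Fin 4 → Fin 4 → MvPolynomial (Fin 3) k) a) F) ∉ Q)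
    (v : Spec (.of (MvPolynomial (Fin 5) k ⧸ Ideal.span {f})))
    (hv : v.asIdeal = Ideal.span (Set.range fun j : Fin 5 => Ideal.Quotient.mk (Ideal.span {f}) (X j))) :
    (IsClosed ({v} : Set (Spec (.of (MvPolynomial (Fin 5) k ⧸ Ideal.span {f})))) ∧
      v ∉ Scheme.regularLocus (Spec (.of (MvPolynomial (Fin 5) k ⧸ Ideal.span {f}))) ∧
      ringKrullDim ((Spec (.of (MvPolynomial (Fin 5) k ⧸ Ideal.span {f}))).presheaf.stalk v) = (4 : ℕ)) ∧
    (∀ (S' : Scheme.{0}) (g : S' ⟶ Spec ((Spec (.of (MvPolynomial (Fin 5) k ⧸ Ideal.span {f}))).presheaf.stalk v)),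
      IsBlowup g ((affineBlowup.idealSheaf (Ideal.span (Set.range (fun j : Fin 5 => Ideal.Quotient.mk (Ideal.span {f}) (X j))))).comap
        ((Spec (.of (MvPolynomial (Fin 5) k ⧸ Ideal.span {f}))).fromSpecStalk v)) →
      (((affineBlowup.idealSheaf (Ideal.span (Set.range (fun j : Fin 5 => Ideal.Quotient.mk (Ideal.span {f}) (X j))))).comap
          ((Spec (.of (MvPolynomial (Fin 5) k ⧸ Ideal.span {f}))).fromSpecStalk v)) ≠ ⊥ ∧
        (((((affineBlowup.idealSheaf (Ideal.span (Set.range (fun j : Fin 5 => Ideal.Quotient.mk (Ideal.span {f}) (X j))))).comap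
            ((Spec (.of (MvPolynomial (Fin 5) k ⧸ Ideal.span {f}))).fromSpecStalk v))).support :
              Set (Spec ((Spec (.of (MvPolynomial (Fin 5) k ⧸ Ideal.span {f}))).presheaf.stalk v))) ⊆
            (Scheme.regularLocus (Spec ((Spec (.of (MvPolynomial (Fin 5) k ⧸ Ideal.span {f}))).presheaf.stalk v)))ᶜ) ∧
        (∀ s : S', g.base s ≠ closedPoint ((Spec (.of (MvPolynomial (Fin 5) k ⧸ Ideal.span {f}))).presheaf.stalk v) → s ∈ Scheme.regularLocus S') ∧
        (∀ s : S', CMCl (S'.presheaf.stalk s))) ∧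
      (∀ s : S', FullCl p (S'.presheaf.stalk s))) ∧
    TStepGerm.TStepInstanceAt p v ((affineBlowup.idealSheaf (Ideal.span (Set.range fun j : Fin 5 => Ideal.Quotient.mk (Ideal.span {f}) (X j)))).comap
      ((Spec (.of (MvPolynomial (Fin 5) k ⧸ Ideal.span {f}))).fromSpecStalk v)) := by
  have h2 : (2 : k) ≠ 0 := by exact_mod_cast X2Cubic4Specimen.natCast_ne_zero_of_prime_ne k p 2 (by norm_num) hp2
  exact ⟨X2FormPointFloor.vertex_closed_singular_deg k 4 (by norm_num) F hF f hf hprime v hv,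
    X2QuarticPointFloor.pointFloor_legal_full_quartic k p hp2 F hF f hf hprime hoff hws v hv,
    tStepInstanceAt_of_doublePoint_quarticForm k h2 p F hF f hf hprime hoff hws v hv⟩

end Summit.ResolutionOfSingularities.ResolutionOfSingularities.Theorems.FInjectiveMacaulayfication.QuarticFrontEnd

end
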